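import Summits.AtomisticToContinuum.BoseEinsteinCondensation.Theses.BECInsertionCorrector
import Summits.AtomisticToContinuum.BoseEinsteinCondensation.Theses.BECSectorPoincareTwoScale
import Summits.AtomisticToContinuum.BoseEinsteinCondensation.Theorems.StaticResponseBound.Negative.Basic
import Literature.MathematicalPhysics.QuantumManyBody.BoseGasStructureFactor
import Literature.MathematicalPhysics.QuantumManyBody.PeriodicBoseGasMomentumSector
import Literature.MathematicalPhysics.QuantumManyBody.BoseGasThermodynamicLimitRuelle
import HarnessLib

/-!
# The energy-controlled structure factor implies torus hyperuniformity (stmt-9093)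

Helper (calibration) file for the crux `BECInsertionCorrector.StaticResponseBound`
(item stmt-AtomisticToContinuum-12057; this file supports, does not close, the item), line
`stable-fraction-square-completion`, registered sub-goal `torusHyperuniformity_of_ecsf` of the line's
open core, the ENERGY-CONTROLLED STRUCTURE FACTOR (ECSF; conclusion of stub C1
`stub_ecsf_of_hyperuniformity`, first hypothesis of stub C3 `stub_windowAssembly` of the checked skeleton
`Cruxes/StaticResponseBound/Lines/stable-fraction-square-completion.lean`).

ECSF reads: for every repulsive finite-range `v` and every window parameter `M₀ > 0` there are
`ρ₀, θ > 0`, `C_H ≥ 0` such that for `0 < ρ < ρ₀`, ALL `N ≥ 1`, all modes `k ∈ ℤ³ ∖ {0}` with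
`|p|² ≤ M₀² ρa` (`p = 2πk/L`, `L = (N/ρ)^{1/3}`, `a` the scattering length) and EVERY finite-energy
periodic state `Φ` in the box `L`,
`λ ⟨|ρ̂_p|²⟩_Φ ≤ (E_Φ − E₀) + λ C_H N |p| / √(ρa)`, `λ = θ (8πa + |p|²/(2ρ)) / L³`.
The OTHER route's open crux `BECSectorPoincareTwoScale.TorusHyperuniformity`
(item stmt-AtomisticToContinuum-9093) asks, for every `M₀ > 0`, for `C, ρ₀ > 0` with: for
`0 < ρ < ρ₀`, EVENTUALLY in `N`, every box `L > 0` in the density window `ρ/2 ≤ N/L³ ≤ 2ρ` admits a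
slack `δ > 0` such that every `δ`-near-minimiser `Ψ` of the periodic energy has
`inf_c ∫ |ρ̂_p − c|² |Ψ|² ≤ C N k / √(ρa)` for all `m ≠ 0` with `k = (2π/L)|m| ≤ M₀ √(ρa)`.

This file kernel-certifies **ECSF ⟹ stmt-9093 by name** (`torusHyperuniformity_of_ecsf`), so that the
line's open core is mapped onto (and ranked above) the existing item.  Proof: given `(v, M₀)` apply
ECSF at `(v, 2M₀)` (output `ρ_E, θ, C_H`) and answer with `C := 2 C_H + 2`,
`ρ₀ := min(ρ_E/2, ρ₁/2)`, where `ρ₁` is a finiteness density of `v` (below); the claim is proved for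
ALL `N ≥ 1`.  For a box `L` in the window put `ρ' := N/L³ ∈ [ρ/2, 2ρ] ⊂ (0, ρ_E)`; then
`sideLength ρ' N = L` literally (`(N/(N/L³))^{1/3} = L`), so ECSF at `(ρ', N, m)` speaks about the
finite-energy periodic states of the very box `L` (a rewrite along this equation).  The ground-state
energy of the box is finite (`ecsf9093_periodicGroundStateEnergy_ne_top`: Ruelle finiteness below
close packing in NON-asymptotic form — `E₀^per(N, L) ≤ E₀^D(N, L − R) ≤ N E₀^D(1, 1) < ∞` by
periodising Dirichlet states and filling the padded box with `N` singletons in unit cells, valid as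
soon as `64 N (1+R)³ ≤ L³`), so with the slack `δ := θ (8πa/L³) · N (2π/L) / √(ρ'a)` every
`δ`-near-minimiser `Ψ` has finite energy and excess `E_Ψ − E₀ ≤ δ ≤ λ N |p| / √(ρ'a)` for every
mode (`λ ≥ θ 8πa / L³`, `|p| ≥ 2π/L`).  Inside the window `|p|² = k² ≤ M₀² ρa ≤ (2M₀)² ρ'a`, ECSF
gives `λ ⟨|ρ̂_p|²⟩_Ψ ≤ λ (1 + C_H) N |p| / √(ρ'a)`, i.e. `⟨|ρ̂_p|²⟩_Ψ ≤ (2 C_H + 2) N |p| / √(ρa)`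
(`√(ρa) ≤ 2 √(ρ'a)`), and the infimum over `c` is at most its value at `c = 0`, which is this raw
second moment (Bochner = lower Lebesgue integral for the continuous non-negative integrand).  If
`a = 0` the window contains no nonzero mode and there is nothing to prove.

Contents: `ecsf9093_periodicGroundStateEnergy_ne_top` (finiteness in the dilute window),
`ecsf9093_sideLength_eq`, `ecsf9093_latticeMomentum_eq_sqrt_psq`, `ecsf9093_two_pi_div_le_sqrt_psq`,
`ecsf9093_lintegral_densityWave_sq_eq` (Bochner form of the second moment), the real-variable
bookkeeping `ecsf9093_arith`, and the glue theorem.  No new definitions.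

References: the line skeleton (above); D. Ruelle, *Statistical Mechanics: Rigorous Results* (1969),
§3.5.11 (finiteness below close packing, as vendored in `BoseGasThermodynamicLimitRuelle`);
E. H. Lieb, R. Seiringer, J. P. Solovej, J. Yngvason, *The Mathematics of the Bose Gas and its
Condensation* (2005), Ch. 2 after (2.2) (periodic ≤ Dirichlet); L. Reatto, G. V. Chester, Phys. Rev.
155 (1967) 88 (hyperuniformity `S(k) ∼ |k|/(2mc)` of the Bose ground state).
-/

namespace Summit.AtomisticToContinuum.BoseEinsteinCondensation.Cruxes.StaticResponseBound.StableFractionSquareCompletion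

open MeasureTheory
open scoped ENNReal ComplexConjugate
open Literature.MathematicalPhysics.QuantumManyBody.BoseGas
open Summit.AtomisticToContinuum.BoseEinsteinCondensation.Theses
open Summit.AtomisticToContinuum.BoseEinsteinCondensation.Theorems.StaticResponseBound.Negative

noncomputable section

/-! ## Finiteness of the periodic ground-state energy in the dilute window -/

/-- **Finite periodic box energies in the dilute window** (Ruelle finiteness below close packing,
non-asymptotic form): for a repulsive finite-range `v` (hard cores allowed) there is `ρ₁ > 0` such
that `E₀^per(N, L) ≠ ⊤` whenever `N ≥ 1`, `L > 0` and `N ≤ ρ₁ L³`.  Proof: with `R > 0` a range of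
`v` and `m` the least integer with `N ≤ m³` (so `m³ ≤ 8N`), `2m(1+R) ≤ L` once `64 N (1+R)³ ≤ L³`;
then `E₀^per(N, L) ≤ E₀^D(N, L − R)` (periodise Dirichlet states, the padding kills the images,
`periodicGroundStateEnergy_le_groundStateEnergy_of_range`) and `E₀^D(N, L − R) ≤ N · E₀^D(1, 1) < ⊤`
(`N` singletons in unit cells at mutual distance `≥ R`, `groundStateEnergy_le_sum_cells`,
`groundStateEnergy_one_lt_top`). [folklore] -/
theorem ecsf9093_periodicGroundStateEnergy_ne_top {v : ℝ → ℝ≥0∞} (hv : IsRepulsiveFiniteRange v) :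
    ∃ ρ₁ : ℝ, 0 < ρ₁ ∧ ∀ (N : ℕ) (L : ℝ), 0 < N → 0 < L → (N : ℝ) ≤ ρ₁ * L ^ 3 →
      periodicGroundStateEnergy v N L ≠ ⊤ := by
  obtain ⟨R, hR, hv0⟩ := hv.exists_pos_range
  refine ⟨1 / (64 * (1 + R) ^ 3), by positivity, fun N L hN hL hNL => ?_⟩
  rw [one_div_mul_eq_div, le_div_iff₀ (by positivity)] at hNL
  -- the least `m` with `N ≤ m³` has `m³ ≤ 8 N`
  obtain ⟨m, hNm, hm8⟩ : ∃ m : ℕ, N ≤ m ^ 3 ∧ m ^ 3 ≤ 8 * N := by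
    have hex : ∃ m : ℕ, N ≤ m ^ 3 := ⟨N, Nat.le_self_pow three_ne_zero N⟩
    refine ⟨Nat.find hex, Nat.find_spec hex, ?_⟩
    rcases Nat.eq_zero_or_pos (Nat.find hex) with h0 | hpos
    · rw [h0]; simp
    · obtain ⟨j, hj⟩ : ∃ j, Nat.find hex = j + 1 := ⟨Nat.find hex - 1, by omega⟩
      have hjN : ¬ N ≤ j ^ 3 := Nat.find_min hex (by omega)
      rw [not_le] at hjN
      rw [hj]
      rcases Nat.eq_zero_or_pos j with hj0 | hjpos
      · subst hj0
        simpa using (show 1 ≤ 8 * N by omega)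
      · have hle : j + 1 ≤ 2 * j := by omega
        have h3 := Nat.pow_le_pow_left hle 3
        have h8 : (2 * j) ^ 3 = 8 * j ^ 3 := by ring
        rw [h8] at h3
        linarith
  have hm1 : 1 ≤ m := by
    rcases Nat.eq_zero_or_pos m with h | h
    · rw [h] at hNm; simp at hNm; omega
    · exact h
  -- geometry: `2 m (1 + R) ≤ L`, hence `m (1 + R) ≤ L - R`
  have hmR : (m : ℝ) ^ 3 ≤ 8 * N := by exact_mod_cast hm8
  have hcube : (2 * (m : ℝ) * (1 + R)) ^ 3 ≤ L ^ 3 :=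
    calc (2 * (m : ℝ) * (1 + R)) ^ 3 = 8 * (m : ℝ) ^ 3 * (1 + R) ^ 3 := by ring
      _ ≤ 8 * (8 * (N : ℝ)) * (1 + R) ^ 3 := by gcongr
      _ = (N : ℝ) * (64 * (1 + R) ^ 3) := by ring
      _ ≤ L ^ 3 := hNL
  have h2m : 2 * (m : ℝ) * (1 + R) ≤ L := le_of_pow_le_pow_left₀ three_ne_zero hL.le hcube
  have hm1' : (1 : ℝ) ≤ m := by exact_mod_cast hm1
  have hmL : (m : ℝ) * (1 + R) ≤ L - R := by nlinarith
  -- periodic ≤ Dirichlet in the padded box `Λ_{L - R}`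
  have hper : periodicGroundStateEnergy v N L ≤ groundStateEnergy v N (L - R) :=
    periodicGroundStateEnergy_le_groundStateEnergy_of_range hv0 hL (by linarith) (by linarith) N
  -- `N` singletons in unit cells of the `m × m × m` grid
  let T : Finset (Fin (m ^ 3)) := Finset.univ.map (Fin.castLEEmb hNm)
  have hT : (∑ c ∈ T, (fun _ : Fin (m ^ 3) => (1 : ℕ)) c) = N := by simp [T]
  have hcells := groundStateEnergy_le_sum_cells (v := v) hv.1 hv0 hR.le one_pos hmL T fun _ => 1
  have hlt : periodicGroundStateEnergy v N L < ⊤ :=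
    calc periodicGroundStateEnergy v N L ≤ groundStateEnergy v N (L - R) := hper
      _ = groundStateEnergy v (∑ c ∈ T, (fun _ : Fin (m ^ 3) => (1 : ℕ)) c) (L - R) := by rw [hT]
      _ ≤ ∑ c ∈ T, groundStateEnergy v ((fun _ : Fin (m ^ 3) => (1 : ℕ)) c) 1 := hcells
      _ < ⊤ := ENNReal.sum_lt_top.2 fun _ _ => groundStateEnergy_one_lt_top v one_pos
  exact hlt.ne

/-! ## Window bookkeeping -/

/-- In the density window the box IS the thermodynamic box of its own density:
`sideLength (N/L³) N = (N/(N/L³))^{1/3} = L` (`L > 0`, `N ≥ 1`). [folklore] -/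
theorem ecsf9093_sideLength_eq {N : ℕ} {L : ℝ} (hN : 0 < N) (hL : 0 < L) :
    sideLength ((N : ℝ) / L ^ 3) N = L := by
  have hN' : (N : ℝ) ≠ 0 := by exact_mod_cast hN.ne'
  rw [sideLength, div_div_cancel₀ hN', show (1 / 3 : ℝ) = ((3 : ℕ) : ℝ)⁻¹ by norm_num]
  exact Real.pow_rpow_inv_natCast hL.le three_ne_zero

/-- The momentum scale of stmt-9093 is the line's `|p|`: `(2π/L)‖m‖ = √(psq L m)` for `L > 0`. [folklore] -/
theorem ecsf9093_latticeMomentum_eq_sqrt_psq {L : ℝ} (hL : 0 < L) (m : Fin 3 → ℤ) :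
    2 * Real.pi / L * ‖(WithLp.toLp 2 fun t => (m t : ℝ) : EuclideanSpace ℝ (Fin 3))‖ =
      Real.sqrt (psq L m) := by
  -- adapted from `wa_norm_latticeMomentum` (Theorems/BECInsertionCorrectorStaticResponseBoundWindowAssembly)
  have hc : 0 ≤ 2 * Real.pi / L := by positivity
  have hsum : ∑ i, ‖(WithLp.toLp 2 fun t => (m t : ℝ) : EuclideanSpace ℝ (Fin 3)) i‖ ^ 2 =
      ∑ i, (m i : ℝ) ^ 2 :=
    Finset.sum_congr rfl fun i _ => by simp
  rw [EuclideanSpace.norm_eq, hsum, psq, Real.sqrt_mul' _ (Finset.sum_nonneg fun i _ => sq_nonneg _),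
    Real.sqrt_sq hc]

/-- A nonzero mode is at least the lowest one: `2π/L ≤ √(psq L m)` for `m ∈ ℤ³ ∖ {0}`, `L > 0`
(`∑ᵢ mᵢ² ≥ 1`). [folklore] -/
theorem ecsf9093_two_pi_div_le_sqrt_psq {L : ℝ} (hL : 0 < L) {m : Fin 3 → ℤ} (hm : m ≠ 0) :
    2 * Real.pi / L ≤ Real.sqrt (psq L m) := by
  have hc : 0 ≤ 2 * Real.pi / L := by positivity
  obtain ⟨i, hi⟩ : ∃ i, m i ≠ 0 := by
    by_contra h
    exact hm (funext fun i => not_not.mp (not_exists.mp h i))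
  have h1 : (1 : ℝ) ≤ (m i : ℝ) ^ 2 := by
    have h1z : (1 : ℤ) ≤ m i ^ 2 := by
      have habs := Int.one_le_abs hi
      nlinarith [sq_abs (m i)]
    exact_mod_cast h1z
  have hone : (1 : ℝ) ≤ ∑ j, (m j : ℝ) ^ 2 :=
    h1.trans (Finset.single_le_sum (f := fun j => (m j : ℝ) ^ 2) (fun j _ => sq_nonneg _)
      (Finset.mem_univ i))
  refine Real.le_sqrt_of_sq_le ?_
  unfold psq
  exact le_mul_of_one_le_right (sq_nonneg _) hone

/-- The raw second moment of the density wave as a Bochner integral: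
`∫⁻ ‖ρ̂_m‖₊² ‖Ψ‖₊² = ofReal (∫ ‖ρ̂_m‖² ‖Ψ‖²)` on the fundamental cell (continuous integrand on a
bounded cell). [folklore] -/
theorem ecsf9093_lintegral_densityWave_sq_eq {N : ℕ} {L : ℝ} (m : Fin 3 → ℤ)
    (Ψ : PeriodicTrialState N L) :
    ∫⁻ X in cellN N L, (‖densityWave N L m X‖₊ : ℝ≥0∞) ^ 2 * (‖Ψ.ψ X‖₊ : ℝ≥0∞) ^ 2 =
      ENNReal.ofReal (∫ X in cellN N L, ‖densityWave N L m X‖ ^ 2 * ‖Ψ.ψ X‖ ^ 2) := by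
  have hcont : Continuous fun X => ‖densityWave N L m X‖ ^ 2 * ‖Ψ.ψ X‖ ^ 2 :=
    ((continuous_densityWave L m).norm.pow 2).mul ((Ψ.contDiff.continuous.norm).pow 2)
  have hint : Integrable (fun X => ‖densityWave N L m X‖ ^ 2 * ‖Ψ.ψ X‖ ^ 2)
      (volume.restrict (cellN N L)) :=
    integrableOn_cellN hcont L
  rw [ofReal_integral_eq_lintegral_ofReal hint (Filter.Eventually.of_forall fun X => by positivity)]
  refine lintegral_congr fun X => ?_
  rw [ENNReal.ofReal_mul (sq_nonneg _), ← coe_nnnorm_sq_eq_ofReal, ← coe_nnnorm_sq_eq_ofReal]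

/-- **The window arithmetic of the calibration** (pure real variables).  From the ECSF inequality
`λ I ≤ E + λ (C_H N s_P / S')`, the excess bound `E ≤ λ₀ (N k₀ / S')` with `0 < λ₀ ≤ λ`,
`0 ≤ k₀ ≤ s_P`, and the density window `S ≤ 2 S'` (`S = √(ρa)`, `S' = √(ρ'a)`):
`I ≤ (2 C_H + 2) N s_P / S`. [folklore] -/
theorem ecsf9093_arith {I E lam lam₀ CH Nr sP k₀ S S' : ℝ} (hlam₀ : 0 < lam₀) (hlam : lam₀ ≤ lam)
    (hCH : 0 ≤ CH) (hNr : 0 ≤ Nr) (hk₀ : 0 ≤ k₀) (hk : k₀ ≤ sP) (hS : 0 < S) (hS' : 0 < S')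
    (hSS' : S ≤ 2 * S') (hEd : E ≤ lam₀ * (Nr * k₀ / S'))
    (hecsf : lam * I ≤ E + lam * (CH * Nr * sP / S')) :
    I ≤ (2 * CH + 2) * Nr * sP / S := by
  have hlam' : 0 < lam := hlam₀.trans_le hlam
  have hsP : 0 ≤ sP := hk₀.trans hk
  have h1 : E ≤ lam * (Nr * sP / S') := by
    refine hEd.trans ?_
    have : Nr * k₀ / S' ≤ Nr * sP / S' := by gcongr
    exact mul_le_mul hlam this (by positivity) hlam'.le
  have h2 : I ≤ (1 + CH) * Nr * sP / S' := by
    refine le_of_mul_le_mul_left ?_ hlam'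
    calc lam * I ≤ E + lam * (CH * Nr * sP / S') := hecsf
      _ ≤ lam * (Nr * sP / S') + lam * (CH * Nr * sP / S') := by linarith
      _ = lam * ((1 + CH) * Nr * sP / S') := by ring
  refine h2.trans ?_
  rw [div_le_div_iff₀ hS' hS]
  have h3 : 0 ≤ (1 + CH) * Nr * sP := by positivity
  nlinarith

/-! ## The glue: ECSF ⟹ `TorusHyperuniformity` (stmt-9093) -/

/-- **Calibration: the energy-controlled structure factor (the open core of line
`stable-fraction-square-completion`, written out in tree vocabulary) implies
`BECSectorPoincareTwoScale.TorusHyperuniformity` (stmt-AtomisticToContinuum-9093) BY NAME, for all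
`N ≥ 1`.**  Given `(v, M₀)`, apply ECSF at `(v, 2M₀)` with output `(ρ_E, θ, C_H)` and take
`C := 2C_H + 2`, `ρ₀ := min(ρ_E/2, ρ₁/2)` (`ρ₁` from `ecsf9093_periodicGroundStateEnergy_ne_top`); for a
box `L` in the density window use ECSF at the density `ρ' := N/L³` (`sideLength ρ' N = L`), the slack
`δ := θ(8πa/L³) N (2π/L)/√(ρ'a)` (finite `E₀`, so near-minimisers have finite energy and excess
`≤ λ N|p|/√(ρ'a)`), the window transfer `|p|² ≤ M₀²ρa ≤ (2M₀)²ρ'a`, `inf_c ≤` (value at `c = 0`), and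
`√(ρa) ≤ 2√(ρ'a)`; for `a = 0` the window is empty. [folklore] -/
theorem torusHyperuniformity_of_ecsf :
    (∀ v : ℝ → ℝ≥0∞, IsRepulsiveFiniteRange v → ∀ M₀ : ℝ, 0 < M₀ →
      ∃ ρ₀ : ℝ, 0 < ρ₀ ∧ ∃ θ : ℝ, 0 < θ ∧ ∃ C_H : ℝ, 0 ≤ C_H ∧
        ∀ ρ : ℝ, 0 < ρ → ρ < ρ₀ → ∀ N : ℕ, 0 < N → ∀ k : Fin 3 → ℤ, k ≠ 0 →
          psq (sideLength ρ N) k ≤ M₀ ^ 2 * (ρ * (scatteringLength v).toReal) →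
          ∀ Φ : PeriodicTrialState N (sideLength ρ N), periodicEnergy v Φ ≠ ⊤ →
            θ * (8 * Real.pi * (scatteringLength v).toReal + psq (sideLength ρ N) k / (2 * ρ)) /
                sideLength ρ N ^ 3 *
                (∫ X in cellN N (sideLength ρ N),
                  ‖densityWave N (sideLength ρ N) k X‖ ^ 2 * ‖Φ.ψ X‖ ^ 2) ≤
              (periodicEnergy v Φ).toReal - (periodicGroundStateEnergy v N (sideLength ρ N)).toReal +
                θ * (8 * Real.pi * (scatteringLength v).toReal + psq (sideLength ρ N) k / (2 * ρ)) /
                  sideLength ρ N ^ 3 *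
                  (C_H * N * Real.sqrt (psq (sideLength ρ N) k) /
                    Real.sqrt (ρ * (scatteringLength v).toReal))) →
    Summit.AtomisticToContinuum.BoseEinsteinCondensation.Theses.BECSectorPoincareTwoScale.TorusHyperuniformity := by
  intro hE v hv M₀ hM₀
  obtain ⟨ρE, hρE, θ, hθ, C_H, hCH, hE'⟩ := hE v hv (2 * M₀) (by positivity)
  obtain ⟨ρ₁, hρ₁, hfin⟩ := ecsf9093_periodicGroundStateEnergy_ne_top hv
  refine ⟨2 * C_H + 2, by positivity, min (ρE / 2) (ρ₁ / 2), lt_min (by positivity) (by positivity),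
    fun ρ hρ hρlt => ?_⟩
  have hρE' : ρ < ρE / 2 := hρlt.trans_le (min_le_left _ _)
  have hρ₁' : ρ < ρ₁ / 2 := hρlt.trans_le (min_le_right _ _)
  refine Filter.eventually_atTop.2 ⟨1, ?_⟩
  intro N hN L hL hlo hhi
  have hN0 : 0 < N := hN
  have hNr : (0 : ℝ) < N := by exact_mod_cast hN0
  have hL3 : 0 < L ^ 3 := by positivity
  -- the density of the box `L` and the identification of the boxes
  obtain ⟨ρ', hρ'⟩ : ∃ ρ' : ℝ, ρ' = (N : ℝ) / L ^ 3 := ⟨_, rfl⟩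
  rw [← hρ'] at hlo hhi
  have hρ'pos : 0 < ρ' := by linarith
  have hρ'E : ρ' < ρE := by linarith
  have hside : sideLength ρ' N = L := by rw [hρ']; exact ecsf9093_sideLength_eq hN0 hL
  -- finiteness of the ground-state energy of the box
  have hE₀ : periodicGroundStateEnergy v N L ≠ ⊤ := by
    refine hfin N L hN0 hL ?_
    have h1 : (N : ℝ) ≤ 2 * ρ * L ^ 3 := by
      have h := hhi
      rw [hρ', div_le_iff₀ hL3] at h
      exact h
    have h2 : 2 * ρ * L ^ 3 ≤ ρ₁ * L ^ 3 := mul_le_mul_of_nonneg_right (by linarith) hL3.le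
    linarith
  -- the scattering length: `a = 0` makes the window empty
  have ha0 : 0 ≤ (scatteringLength v).toReal := ENNReal.toReal_nonneg
  rcases ha0.eq_or_lt with ha | ha
  · refine ⟨1, one_pos, fun Ψ _ m hm => ?_⟩
    dsimp only
    intro hk
    exfalso
    rw [← ha, mul_zero, Real.sqrt_zero, mul_zero, ecsf9093_latticeMomentum_eq_sqrt_psq hL] at hk
    have hpos : 0 < Real.sqrt (psq L m) :=
      lt_of_lt_of_le (by positivity) (ecsf9093_two_pi_div_le_sqrt_psq hL hm)
    linarith
  -- `a > 0`: the slack `δ = θ (8πa/L³) · N (2π/L) / √(ρ'a)`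
  have hρ'a : 0 < ρ' * (scatteringLength v).toReal := mul_pos hρ'pos ha
  obtain ⟨δr, hδr⟩ : ∃ δr : ℝ, δr = θ * (8 * Real.pi * (scatteringLength v).toReal) / L ^ 3 *
      ((N : ℝ) * (2 * Real.pi / L) / Real.sqrt (ρ' * (scatteringLength v).toReal)) := ⟨_, rfl⟩
  have hδr0 : 0 < δr := by rw [hδr]; positivity
  refine ⟨ENNReal.ofReal δr, ENNReal.ofReal_pos.mpr hδr0, fun Ψ hΨ m hm => ?_⟩
  dsimp only
  intro hk
  rw [ecsf9093_latticeMomentum_eq_sqrt_psq hL] at hk ⊢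
  -- the near-minimiser has finite energy and small excess
  have htop : periodicGroundStateEnergy v N L + ENNReal.ofReal δr ≠ ⊤ :=
    ENNReal.add_ne_top.mpr ⟨hE₀, ENNReal.ofReal_ne_top⟩
  have hΨtop : periodicEnergy v Ψ ≠ ⊤ := ne_top_of_le_ne_top htop hΨ
  have hexcess : (periodicEnergy v Ψ).toReal - (periodicGroundStateEnergy v N L).toReal ≤
      θ * (8 * Real.pi * (scatteringLength v).toReal) / L ^ 3 *
        ((N : ℝ) * (2 * Real.pi / L) / Real.sqrt (ρ' * (scatteringLength v).toReal)) := by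
    have h := ENNReal.toReal_mono htop hΨ
    rw [ENNReal.toReal_add hE₀ ENNReal.ofReal_ne_top, ENNReal.toReal_ofReal hδr0.le, hδr] at h
    linarith
  -- the window at density `ρ'` with parameter `2M₀`
  have hP : 0 < psq L m :=
    Real.sqrt_pos.mp (lt_of_lt_of_le (by positivity) (ecsf9093_two_pi_div_le_sqrt_psq hL hm))
  have hwin : psq L m ≤ (2 * M₀) ^ 2 * (ρ' * (scatteringLength v).toReal) := by
    have h1 := pow_le_pow_left₀ (Real.sqrt_nonneg _) hk 2
    rw [Real.sq_sqrt hP.le, mul_pow, Real.sq_sqrt (by positivity)] at h1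
    have h2 : ρ * (scatteringLength v).toReal ≤ 4 * (ρ' * (scatteringLength v).toReal) := by
      nlinarith
    nlinarith [sq_nonneg M₀]
  -- ECSF at `(ρ', N, m)`, read in the box `L`
  have hecsf := hE' ρ' hρ'pos hρ'E N hN0 m hm
  rw [hside] at hecsf
  have hmain := hecsf hwin Ψ hΨtop
  -- `inf_c ≤` the value at `c = 0`, which is the raw second moment
  refine (iInf_le _ (0 : ℂ)).trans ?_
  simp only [sub_zero]
  refine (ecsf9093_lintegral_densityWave_sq_eq m Ψ).trans_le (ENNReal.ofReal_le_ofReal ?_)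
  have hSS' : Real.sqrt (ρ * (scatteringLength v).toReal) ≤
      2 * Real.sqrt (ρ' * (scatteringLength v).toReal) := by
    have h4 : Real.sqrt (2 ^ 2 * (ρ' * (scatteringLength v).toReal)) =
        2 * Real.sqrt (ρ' * (scatteringLength v).toReal) := by
      rw [Real.sqrt_mul (by norm_num) (ρ' * (scatteringLength v).toReal), Real.sqrt_sq (by norm_num)]
    rw [← h4]
    exact Real.sqrt_le_sqrt (by nlinarith)
  have hlam : θ * (8 * Real.pi * (scatteringLength v).toReal) / L ^ 3 ≤
      θ * (8 * Real.pi * (scatteringLength v).toReal + psq L m / (2 * ρ')) / L ^ 3 :=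
    div_le_div_of_nonneg_right
      (mul_le_mul_of_nonneg_left (le_add_of_nonneg_right (by positivity)) hθ.le) hL3.le
  exact ecsf9093_arith (by positivity) hlam hCH hNr.le (by positivity)
    (ecsf9093_two_pi_div_le_sqrt_psq hL hm) (Real.sqrt_pos.mpr (mul_pos hρ ha))
    (Real.sqrt_pos.mpr hρ'a) hSS' hexcess hmain

end

end Summit.AtomisticToContinuum.BoseEinsteinCondensation.Cruxes.StaticResponseBound.StableFractionSquareCompletion
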